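import Mathlib

/-!
# STUB-IDEAS k2 · gen 14 — typed dictionary for the residual audits ρ1 (R121) and ρ2 (R122)
# of HARDEST (a) of `stub_heegnerIndexLowerAtTwo` (crux `SplitBadTwoLowerHalfOfFacts`, item 27851)

Stub-ideation sketch (planner seat `sidea-stub_heegnerIndexLowerAtTwo-2-g14`).  Nothing here proves
BSD, the crux, the stub, or S2′-v11; every theorem below is ℤ/normed-field bookkeeping that TYPES the
page-level findings of the card `Ideas/stub-heegnerindexloweratwo-k2-g14.md`:

* §A  the LEAD's dyadic key `[d]₂ = (d % 2, d′ % 8)`;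
* §B  ρ1(i): Liu–S. Zhang–W. Zhang, *A p-adic Waldspurger formula* (arXiv:1511.08172), proof of
      Prop. 4.12 (p. 23 of the held text): `P_ι(χ) = C_ι · (ζ_ι⁺ ζ_ι⁻)^k · χ^{(ι)}(t₊⁻¹ t₋)` — the member
      enters the in-range period ratio ONLY through a value of a finite-order character, whose norm is
      `1` in every normed division ring (`norm_eq_one_of_pow_eq_one'`, `PeriodRatioShape.norm_value`);
* §C  ρ1(ii): torus-volume / `#Pic(𝒪_c)` conventions — both torus periods are scaled AVERAGES
      (LZZ §3.3: total volume 1; YZZ as quoted by Cai–Shu–Tian arXiv:1408.1733 p. 15: total volume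
      `2 L(1,η)`), so the same-vector quotient carries NO class-number factor; a MIXED convention
      (c₁-level sums on one side, CST Lemma 2.3) injects `h²`, and the odd part of such an `h` is NOT a
      function of the dyadic key (`relPicOddFactor_not_dyadic`: ℓ = 17 vs ℓ = 113, both ≡ 1 (mod 8));
* §D  ρ2: depth bookkeeping `n_v(key) ∈ {2, 3}` (LZZ impose no condition at 𝔭: Def. 1.5 / Def. 3.7);
* §E  the shrunken crux K1′ `TwoLocalLedger` ⟹ key-rigidity ⟹ the LEAD's `∃ eA : ℤ → ℤ → ℤ` shape.
-/

namespace Summit.BirchSwinnertonDyer.BirchSwinnertonDyer.Cruxes.SplitBadTwoLowerHalfOfFacts.HeegnerIndexTwo.K2G14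

/-! ## §A  The dyadic key of a squarefree twist parameter `d` -/

/-- `d′ = d` if `d` is odd, `d′ = d / 2` if `d` is even (for squarefree `d`). -/
def oddPart (d : ℤ) : ℤ := d / (2 - d % 2)

/-- The LEAD's key `[d]₂ = (d % 2, d′ % 8)`, i.e. the class of `d` in `ℚ₂ˣ/ℚ₂ˣ²` for squarefree `d`. -/
def key (d : ℤ) : ℤ × ℤ := (d % 2, oddPart d % 8)

/-- In-tree anchor `d = -1` (N = 784) has key `(1,7)`. -/
example : key (-1) = (1, 7) := by decide
/-- The `d = ± 2` anchors (N = 3136) have keys `(0,1)` and `(0,7)`. -/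
example : key 2 = (0, 1) ∧ key (-2) = (0, 7) := by decide
/-- The S0″ print anchor `d₀ = -62` has key `(0,1)`; `d₀ = -5` has key `(1,3)`. -/
example : key (-62) = (0, 1) ∧ key (-5) = (1, 3) := by decide
/-- The two witnesses of §C lie in ONE key class, that of the anchor `d = -1`. -/
theorem key_neg17_eq_key_neg113 : key (-17) = key (-113) ∧ key (-17) = key (-1) := by decide

/-! ## §B  ρ1(i): the in-range period ratio (LZZ Prop. 4.12, proof) -/

/-- Roots of unity have norm one in any normed division ring (Mathlib has the `ℂ` case only). -/
theorem norm_eq_one_of_pow_eq_one' {K : Type*} [NormedDivisionRing K] {u : K} {n : ℕ}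
    (hn : n ≠ 0) (h : u ^ n = 1) : ‖u‖ = 1 := by
  have h' : ‖u‖ ^ n = 1 := by rw [← norm_pow, h, norm_one]
  exact (pow_eq_one_iff_of_nonneg (norm_nonneg u) hn).mp h'

/-- A value of a character of a finite group has norm one. This is the fate of the factor
`χ′_d^{(ι)}(t₊⁻¹ t₋)` of LZZ's period ratio for the finite-order member character `χ′_d`. -/
theorem norm_map_eq_one_of_finite {G K : Type*} [Group G] [Finite G] [NormedDivisionRing K]
    (χ : G →* K) (g : G) : ‖χ g‖ = 1 := by
  obtain ⟨n, hn, hgn⟩ := (isOfFinOrder_iff_pow_eq_one).mp (isOfFinOrder_of_finite g)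
  exact norm_eq_one_of_pow_eq_one' hn.ne' (by rw [← map_pow, hgn, map_one])

/-- LZZ p. 23 (proof of Prop. 4.12) typed: at an in-range point `χ = χ′ · κ_k` (finite-order member
part `χ′`, member-independent weight-`k` part `κ_k`) the period ratio is
`P_ι(χ) = C_ι(k) · (ζ⁺ζ⁻)^k · κ_k(t₊⁻¹t₋) · χ′(t₊⁻¹t₋)`; we lump the three member-independent factors
into `memberFree` and keep the member's root of unity `u`. -/
structure PeriodRatioShape (K : Type*) [NormedDivisionRing K] where
  /-- `C_ι(k) · (ζ_ι⁺ζ_ι⁻)^k · κ_k(t₊⁻¹t₋)`: depends on `(A = A_{f₀}, k, ι, ψ, c, P⁺)` only. -/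
  memberFree : K
  /-- `χ′_d^{(ι)}(t₊⁻¹t₋)`: the ONLY member-dependent factor. -/
  u : K
  /-- `χ′_d` has finite order. -/
  u_finiteOrder : ∃ n : ℕ, n ≠ 0 ∧ u ^ n = 1

namespace PeriodRatioShape

variable {K : Type*} [NormedDivisionRing K]

/-- The in-range period ratio of the member. -/
def value (P : PeriodRatioShape K) : K := P.memberFree * P.u

/-- ρ1(i) VERDICT, typed: the norm of the period ratio is member-free. -/
theorem norm_value (P : PeriodRatioShape K) : ‖P.value‖ = ‖P.memberFree‖ := by
  obtain ⟨n, hn, h⟩ := P.u_finiteOrder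
  simp [value, norm_mul, norm_eq_one_of_pow_eq_one' hn h]

/-- Two members of the class pinned at the same weight `k` with the same `(A, ι, ψ, c, P⁺)` have period
ratios of the same norm. -/
theorem norm_value_eq_of_memberFree_eq (P₁ P₂ : PeriodRatioShape K)
    (h : P₁.memberFree = P₂.memberFree) : ‖P₁.value‖ = ‖P₂.value‖ := by
  rw [norm_value, norm_value, h]

end PeriodRatioShape

/-! ## §C  ρ1(ii): torus volumes and `#Pic(𝒪_c)` -/

/-- Same-vector quotient with a MIXED convention: if one side uses c-level SUMS `h • P` (CST Lemma 2.3)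
and the other the volume-normalised AVERAGE `P`, the quotient of the two bilinear quantities picks up
`h²`.  (With the SAME convention on both sides `h` cancels: k2-g13 `bilinear_ratio_indep`.) -/
theorem mixed_convention_defect {K : Type*} [Field K] (h x y z : K) :
    (h * x) * (h * y) / z = h ^ 2 * (x * y / z) := by ring

/-- `v₂(2^n · m) = n` for odd `m` (helper for the numerical witnesses below). -/
theorem padicValNat_two_pow_mul_odd (n m : ℕ) (hm : Odd m) : padicValNat 2 (2 ^ n * m) = n := by
  rw [padicValNat.mul (pow_ne_zero _ two_ne_zero) hm.pos.ne', padicValNat.prime_pow,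
    padicValNat.eq_zero_of_not_dvd hm.not_two_dvd_nat, add_zero]

/-- For `K₀ = ℚ(√-7)` (class number 1, `[𝒪^× : 𝒪_c^×] = 1` for `c > 1`) the relative Picard number of
the order of conductor `c = 2^n · ∏ ℓ` is `2^(n-1) · ∏_ℓ (ℓ - (-7/ℓ))` (CST Lemma 2.3).  The odd-prime
factor `ℓ - (-7/ℓ)` is NOT determined by `ℓ mod 8`, hence not by the dyadic key of `d = -ℓ`:
`ℓ = 17` and `ℓ = 113` are both `≡ 1 (mod 8)`, but `(-7/17) = -1`, `(-7/113) = +1`, and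
`v₂(17 + 1) = 1` while `v₂(113 - 1) = 4`. -/
theorem relPicOddFactor_not_dyadic :
    (17 : ℤ) % 8 = 113 % 8 ∧ jacobiSym (-7) 17 = -1 ∧ jacobiSym (-7) 113 = 1 ∧
      padicValNat 2 (17 + 1) = 1 ∧ padicValNat 2 (113 - 1) = 4 := by
  refine ⟨by decide, by norm_num, by norm_num, ?_, ?_⟩
  · have h : (17 + 1 : ℕ) = 2 ^ 1 * 9 := by norm_num
    rw [h]; exact padicValNat_two_pow_mul_odd 1 9 (by decide)
  · have h : (113 - 1 : ℕ) = 2 ^ 4 * 7 := by norm_num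
    rw [h]; exact padicValNat_two_pow_mul_odd 4 7 (by decide)

/-- Consequence for engines (hygiene R124-bis): if an engine identity for `2·v₂Q` carried the relative
Picard number with a nonzero net exponent `p`, the two same-key parameters `d = -17`, `d = -113`
would differ by `p · (4 - 1) ≠ 0` — contradicting key-rigidity.  Pure arithmetic form: -/
theorem netPicExponent_must_vanish (p : ℤ) (hp : p * (4 - 1) = 0) : p = 0 := by omega

/-! ## §D  ρ2: depth bookkeeping (LZZ Def. 1.5 / 3.7 place no condition at `𝔭`; Prop. 4.14 holds at
every depth `n` for `n`-admissible stable vectors, Def. 4.2 / Remark 4.3) -/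

/-- Conductor exponent `n_v` of the member character at `𝔓` and `𝔓̄`: `2` on the odd keys `(1,3),(1,7)`
(`δ = -1`), `3` on the four even keys (`δ = ± 2`). -/
def depth (k : ℤ × ℤ) : ℕ := if k.1 = 1 then 2 else 3

theorem depth_mem (k : ℤ × ℤ) : depth k = 2 ∨ depth k = 3 := by
  unfold depth; split <;> simp

theorem depth_key_eq_of_key_eq {d₁ d₂ : ℤ} (h : key d₁ = key d₂) : depth (key d₁) = depth (key d₂) := by
  rw [h]

/-! ## §E  The shrunken crux K1′: a two-local ledger for `2·v₂Q(W)` -/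

/-- K1′ typed.  `vQ m` stands for `2·v₂Q(W_m)`; the decomposition records WHERE each factor of the
printed formulas lives: `cglob` = member-independent constants (LZZ `2^{g-3}δ^{1/2}ζ(2)/(L(1,η)²L(1,π,Ad))`,
`(2L(1,η))²`, the measure constant of LZZ §1.4, Katz's periods/Γ-factors, `C_ι(ζ⁺ζ⁻)^k κ_k(t₊⁻¹t₋)` at the
pinning weight); `lam` = everything supported at `𝔭 ∣ 2` (LZZ `ε/L²` in range and at weight 0, Katz's local
factors at `𝔓, 𝔓̄`); `uPer` = exponent of `χ′(t₊⁻¹t₋)` (§B: zero); `vol` = net torus-volume / `#Pic`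
exponent (§C: zero in the same-vector quotient); `odd` = odd places (B22(a), k2-g13: zero). -/
structure TwoLocalLedger (M Key : Type*) where
  key : M → Key
  vQ : M → ℤ
  cglob : ℤ
  lam : Key → ℤ
  uPer : M → ℤ
  vol : M → ℤ
  odd : M → ℤ
  decomp : ∀ m, vQ m = cglob + lam (key m) + uPer m + vol m + odd m
  uPer_zero : ∀ m, uPer m = 0
  vol_zero : ∀ m, vol m = 0
  odd_zero : ∀ m, odd m = 0

namespace TwoLocalLedger

variable {M Key : Type*} (L : TwoLocalLedger M Key)

theorem vQ_eq (m : M) : L.vQ m = L.cglob + L.lam (L.key m) := by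
  have := L.decomp m
  rw [L.uPer_zero, L.vol_zero, L.odd_zero] at this
  omega

/-- KEY-RIGIDITY of `2·v₂Q` from the ledger. -/
theorem keyRigid (m₁ m₂ : M) (h : L.key m₁ = L.key m₂) : L.vQ m₁ = L.vQ m₂ := by
  rw [L.vQ_eq, L.vQ_eq, h]

/-- EXISTENCE of the keyed table (the (a-∃) half of HARDEST (a)). -/
theorem exists_keyed : ∃ e : Key → ℤ, ∀ m, L.vQ m = e (L.key m) :=
  ⟨fun k => L.cglob + L.lam k, fun m => L.vQ_eq m⟩

end TwoLocalLedger

/-- The LEAD's shape: with `Key = ℤ × ℤ` read as `(d % 2, d′ % 8)` the ledger yields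
`∃ eA : ℤ → ℤ → ℤ, ∀ m, 2·v₂Q(W_m) = eA (d % 2) (d′ % 8)`. -/
theorem exists_eA_of_ledger {M : Type*} (L : TwoLocalLedger M (ℤ × ℤ)) (d : M → ℤ)
    (hkey : ∀ m, L.key m = key (d m)) :
    ∃ eA : ℤ → ℤ → ℤ, ∀ m, L.vQ m = eA (d m % 2) (oddPart (d m) % 8) := by
  obtain ⟨e, he⟩ := L.exists_keyed
  refine ⟨fun a b => e (a, b), fun m => ?_⟩
  rw [he m, hkey m]; rfl

end Summit.BirchSwinnertonDyer.BirchSwinnertonDyer.Cruxes.SplitBadTwoLowerHalfOfFacts.HeegnerIndexTwo.K2G14
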